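import Literature.MathematicalPhysics.QuantumLattice.SpinChainsAkltBondTableProofs
import HarnessLib

/-!
# Exact positivity certificates for sums of AKLT bond projections

Trunk **T-QLATTICE**. Sibling proof file of
`Literature/MathematicalPhysics/QuantumLattice/SpinChains.lean`, fourth step towards `aklt_gap_holds`:
the generic, model-independent half of the exact finite-size certificates. Given bonds of distinct
sites on `Fin n`, a rational `ε` and a literal certificate `cert = [(d_t, M_t, data_t)]` (weights
`d_t ≥ 0`, vectors `u_t` supported in the magnetisation block `M_t`, sparse entries addressed by a
base-`3` akltCfgKey), the theorem `posSemidef_sq_sub_smul_of_certificate` turns the exact identity of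
rational matrices `akltHamMat² - ε akltHamMat = Σ_t d_t u_t u_tᵀ` — checked entrywise by the kernel
(`decide`) on the entries with `akltCfgKey σ ≤ akltCfgKey τ` in a common block, the rest following from symmetry
(`pTab_symm`) and block diagonality (`pTab_mag`) — into the operator inequality
`(Σ_k P₂(bonds k))² - ε Σ_k P₂(bonds k) ≥ 0` on `Op (Fin n) 3` (via `akltProj_eq_map_bondMat` and
positivity of `Σ_t d_t u_t u_tᵀ`). The computable definitions (`akltHamMat`, `akltCfgMag`, `akltCfgNear`, `akltMspEntry`,
`akltCfgKey`, `akltLookup`, `akltCertVec`, `akltCertMat`) are bookkeeping for this kernel computation; no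
`Prop`-valued definition is introduced.

## Sources

S. Knabe, J. Stat. Phys. **52** (1988) 627–638, §3 (local gaps of short AKLT chains by exact
diagonalisation in the `Sᶻ` basis); M. Lemm, A. W. Sandvik, S. Yang, J. Stat. Phys. **177** (2019)
1077, §3 (numerical verification of a finite-size criterion) — replaced here by exact rational
`LDLᵀ` certificates; H. Tasaki (2020) §7.1.
-/

namespace Literature.MathematicalPhysics.QuantumLattice

/-! ### Exact certificates: from a kernel-checked identity of rational matrices to positivity -/

section Certificate

open Matrix Complex Finset
open scoped ComplexOrder

/-- The rational matrix of `Σ_k P₂(bonds k)` on `n`-site configurations (entrywise sum of bond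
matrices; `hamMat_eq_sum`). [folklore] -/
def akltHamMat (n : ℕ) {m : ℕ} (bonds : Fin m → Fin n × Fin n) :
    Matrix (Fin n → Fin 3) (Fin n → Fin 3) ℚ :=
  Matrix.of fun σ τ => ∑ k : Fin m, bondMat n pTab (bonds k).1 (bonds k).2 σ τ

/-- `akltHamMat` is the sum of the bond matrices. [folklore] -/
theorem hamMat_eq_sum (n : ℕ) {m : ℕ} (bonds : Fin m → Fin n × Fin n) :
    akltHamMat n bonds = ∑ k : Fin m, bondMat n pTab (bonds k).1 (bonds k).2 := by
  ext σ τ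
  rw [akltHamMat, Matrix.of_apply, Matrix.sum_apply]

/-- Casting a product of rational matrices to `ℂ` entrywise. [folklore] -/
theorem map_ratCast_mul {ι : Type*} [Fintype ι] [DecidableEq ι] (A B : Matrix ι ι ℚ) :
    (A * B).map ((↑) : ℚ → ℂ) = A.map ((↑) : ℚ → ℂ) * B.map ((↑) : ℚ → ℂ) := by
  ext i j
  simp only [Matrix.map_apply, Matrix.mul_apply]
  push_cast
  rfl

/-- Casting `A - ε B` to `ℂ` entrywise. [folklore] -/
theorem map_ratCast_sub_smul {ι : Type*} (A B : Matrix ι ι ℚ) (ε : ℚ) :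
    (A - ε • B).map ((↑) : ℚ → ℂ) = A.map ((↑) : ℚ → ℂ) - (ε : ℂ) • B.map ((↑) : ℚ → ℂ) := by
  ext i j
  simp only [Matrix.map_apply, Matrix.sub_apply, Matrix.smul_apply, smul_eq_mul]
  push_cast
  rfl

/-- **The operator `Σ_k P₂(bonds k)` on `Fin n` sites is the cast of `akltHamMat`** (bondwise
`akltProj_eq_map_bondMat`; all bonds join distinct sites). [folklore] -/
theorem sum_akltProj_eq_map_hamMat (n : ℕ) {m : ℕ} (bonds : Fin m → Fin n × Fin n)
    (hb : ∀ k, (bonds k).1 ≠ (bonds k).2) :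
    ∑ k : Fin m, akltProj (bonds k).1 (bonds k).2 = (akltHamMat n bonds).map ((↑) : ℚ → ℂ) := by
  ext σ τ
  rw [akltHamMat, Matrix.map_apply, Matrix.of_apply, Matrix.sum_apply]
  push_cast
  exact Finset.sum_congr rfl fun k _ => by rw [akltProj_eq_map_bondMat (hb k), Matrix.map_apply]

/-! #### Magnetisation blocks -/

/-- The total `Σ_k k` of a configuration (the magnetisation is `n` minus this total). [folklore] -/
def akltCfgMag {n : ℕ} (σ : Fin n → Fin 3) : ℕ := ∑ k : Fin n, (σ k).val

/-- A bond matrix of `pTab` conserves `akltCfgMag` (`pTab_mag` at the bond, equality elsewhere). [folklore] -/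
theorem mag_eq_of_bondMat_ne_zero {n : ℕ} {i j : Fin n} (hij : i ≠ j) {σ τ : Fin n → Fin 3}
    (h : bondMat n pTab i j σ τ ≠ 0) : akltCfgMag σ = akltCfgMag τ := by
  rw [bondMat_apply] at h
  by_cases ha : agreeOff n i j σ τ = true
  · rw [if_pos ha] at h
    have hp := pTab_mag _ _ _ _ h
    rw [agreeOff_eq_true_iff] at ha
    have hsub : ({i, j} : Finset (Fin n)) ⊆ univ := subset_univ _
    unfold akltCfgMag
    rw [← Finset.sum_sdiff hsub, ← Finset.sum_sdiff hsub, Finset.sum_pair hij, Finset.sum_pair hij,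
      hp]
    congr 1
    refine Finset.sum_congr rfl fun k hk => ?_
    simp only [Finset.mem_sdiff, Finset.mem_univ, true_and, Finset.mem_insert, Finset.mem_singleton,
      not_or] at hk
    rw [ha k hk.1 hk.2]
  · rw [if_neg ha] at h
    exact absurd rfl h

/-- `akltHamMat` conserves `akltCfgMag`. [folklore] -/
theorem mag_eq_of_hamMat_ne_zero {n m : ℕ} (bonds : Fin m → Fin n × Fin n)
    (hb : ∀ k, (bonds k).1 ≠ (bonds k).2) {σ τ : Fin n → Fin 3}
    (h : akltHamMat n bonds σ τ ≠ 0) : akltCfgMag σ = akltCfgMag τ := by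
  rw [akltHamMat, Matrix.of_apply] at h
  obtain ⟨k, -, hk⟩ := Finset.exists_ne_zero_of_sum_ne_zero h
  exact mag_eq_of_bondMat_ne_zero (hb k) hk

/-- `akltHamMat² - ε akltHamMat` is block diagonal in the magnetisation `akltCfgMag`. [folklore] -/
theorem hamMat_sq_sub_apply_eq_zero {n m : ℕ} (bonds : Fin m → Fin n × Fin n)
    (hb : ∀ k, (bonds k).1 ≠ (bonds k).2) (ε : ℚ) {σ τ : Fin n → Fin 3} (h : akltCfgMag σ ≠ akltCfgMag τ) :
    (akltHamMat n bonds * akltHamMat n bonds - ε • akltHamMat n bonds) σ τ = 0 := by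
  have h1 : akltHamMat n bonds σ τ = 0 := by
    by_contra h'
    exact h (mag_eq_of_hamMat_ne_zero bonds hb h')
  have h2 : (akltHamMat n bonds * akltHamMat n bonds) σ τ = 0 := by
    rw [Matrix.mul_apply]
    refine Finset.sum_eq_zero fun ρ _ => ?_
    by_cases hσρ : akltHamMat n bonds σ ρ = 0
    · rw [hσρ, zero_mul]
    · by_cases hρτ : akltHamMat n bonds ρ τ = 0
      · rw [hρτ, mul_zero]
      · exact absurd ((mag_eq_of_hamMat_ne_zero bonds hb hσρ).trans
          (mag_eq_of_hamMat_ne_zero bonds hb hρτ)) h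
  rw [Matrix.sub_apply, Matrix.smul_apply, h1, h2, smul_zero, sub_zero]

/-! #### Symmetry -/

/-- `agreeOff` is symmetric. [folklore] -/
theorem agreeOff_comm {n : ℕ} (i j : Fin n) (σ τ : Fin n → Fin 3) :
    agreeOff n i j σ τ = agreeOff n i j τ σ := by
  rw [Bool.eq_iff_iff, agreeOff_eq_true_iff, agreeOff_eq_true_iff]
  exact ⟨fun h k hki hkj => (h k hki hkj).symm, fun h k hki hkj => (h k hki hkj).symm⟩

/-- `akltHamMat` is a symmetric matrix (`pTab_symm`). [folklore] -/
theorem hamMat_transpose {n m : ℕ} (bonds : Fin m → Fin n × Fin n) :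
    (akltHamMat n bonds)ᵀ = akltHamMat n bonds := by
  ext σ τ
  simp only [Matrix.transpose_apply, akltHamMat, Matrix.of_apply, bondMat_apply]
  refine Finset.sum_congr rfl fun k _ => ?_
  rw [agreeOff_comm, pTab_symm]

/-- `akltHamMat² - ε akltHamMat` is symmetric. [folklore] -/
theorem hamMat_sq_sub_apply_comm {n m : ℕ} (bonds : Fin m → Fin n × Fin n) (ε : ℚ)
    (σ τ : Fin n → Fin 3) :
    (akltHamMat n bonds * akltHamMat n bonds - ε • akltHamMat n bonds) σ τ =
      (akltHamMat n bonds * akltHamMat n bonds - ε • akltHamMat n bonds) τ σ := by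
  have hT : (akltHamMat n bonds * akltHamMat n bonds - ε • akltHamMat n bonds)ᵀ =
      akltHamMat n bonds * akltHamMat n bonds - ε • akltHamMat n bonds := by
    rw [Matrix.transpose_sub, Matrix.transpose_smul, Matrix.transpose_mul, hamMat_transpose]
  conv_rhs => rw [← hT]
  rfl

/-! #### The sparse evaluator -/

/-- Boolean test "`ρ` differs from `τ` on at most one bond" (where a column of `akltHamMat` can be
nonzero). [folklore] -/
def akltCfgNear (n : ℕ) {m : ℕ} (bonds : Fin m → Fin n × Fin n) (τ ρ : Fin n → Fin 3) : Bool :=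
  (List.finRange m).any fun k => agreeOff n (bonds k).1 (bonds k).2 ρ τ

/-- Columns of `akltHamMat` are supported on `akltCfgNear`. [folklore] -/
theorem near_of_hamMat_ne_zero {n m : ℕ} (bonds : Fin m → Fin n × Fin n) {τ ρ : Fin n → Fin 3}
    (h : akltHamMat n bonds ρ τ ≠ 0) : akltCfgNear n bonds τ ρ = true := by
  rw [akltHamMat, Matrix.of_apply] at h
  obtain ⟨k, -, hk⟩ := Finset.exists_ne_zero_of_sum_ne_zero h
  rw [bondMat_apply] at hk
  have ha : agreeOff n (bonds k).1 (bonds k).2 ρ τ = true := by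
    by_contra ha
    rw [if_neg ha] at hk
    exact hk rfl
  simp only [akltCfgNear, List.any_eq_true, List.mem_finRange, true_and]
  exact ⟨k, ha⟩

/-- **The sparse evaluator** of `(akltHamMat² - ε akltHamMat)(σ, τ)`: the intermediate configuration of the
product is restricted to the support of the column `τ`. [folklore] -/
def akltMspEntry (n : ℕ) {m : ℕ} (bonds : Fin m → Fin n × Fin n) (ε : ℚ) (σ τ : Fin n → Fin 3) : ℚ :=
  (∑ ρ ∈ univ.filter (fun ρ => akltCfgNear n bonds τ ρ = true), akltHamMat n bonds σ ρ * akltHamMat n bonds ρ τ) -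
    ε * akltHamMat n bonds σ τ

/-- The sparse evaluator computes the entries of `akltHamMat² - ε akltHamMat`. [folklore] -/
theorem mspEntry_eq {n m : ℕ} (bonds : Fin m → Fin n × Fin n) (ε : ℚ) (σ τ : Fin n → Fin 3) :
    akltMspEntry n bonds ε σ τ = (akltHamMat n bonds * akltHamMat n bonds - ε • akltHamMat n bonds) σ τ := by
  rw [akltMspEntry, Matrix.sub_apply, Matrix.smul_apply, Matrix.mul_apply, smul_eq_mul,
    Finset.sum_filter_of_ne]
  intro ρ _ hρ
  exact near_of_hamMat_ne_zero bonds (right_ne_zero_of_mul hρ)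

/-! #### Certificates `Σ_t d_t u_t u_tᵀ` -/

/-- A base-`3` key of a configuration (used only to address the certificate data and to halve the
kernel computation by symmetry; no injectivity is needed). [folklore] -/
def akltCfgKey {n : ℕ} (σ : Fin n → Fin 3) : ℕ :=
  (List.finRange n).foldl (fun acc k => acc * 3 + (σ k).val) 0

/-- Sparse lookup in an association list (`0` if absent). [folklore] -/
def akltLookup (l : List (ℕ × ℚ)) (k : ℕ) : ℚ :=
  match l.find? (fun p => p.1 == k) with
  | some p => p.2
  | none => 0

/-- The vector `u_t` of a certificate term `t = (d, M, data)`: supported in the block `akltCfgMag = M`,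
with entries read off `data` by `akltCfgKey`. [folklore] -/
def akltCertVec {n : ℕ} (t : ℚ × ℕ × List (ℕ × ℚ)) (σ : Fin n → Fin 3) : ℚ :=
  if akltCfgMag σ = t.2.1 then akltLookup t.2.2 (akltCfgKey σ) else 0

/-- The rational matrix `Σ_t d_t u_t u_tᵀ` of a certificate (a literal list of terms). [folklore] -/
def akltCertMat (n : ℕ) (cert : List (ℚ × ℕ × List (ℕ × ℚ))) : Matrix (Fin n → Fin 3) (Fin n → Fin 3) ℚ :=
  (cert.map fun t => Matrix.of fun σ τ => t.1 * akltCertVec t σ * akltCertVec t τ).sum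

/-- Entries of `akltCertMat` (the list sum, entrywise). [folklore] -/
theorem certMat_apply (n : ℕ) (cert : List (ℚ × ℕ × List (ℕ × ℚ))) (σ τ : Fin n → Fin 3) :
    akltCertMat n cert σ τ = (cert.map fun t => t.1 * akltCertVec t σ * akltCertVec t τ).sum := by
  induction cert with
  | nil => rfl
  | cons t rest ih =>
    simp only [akltCertMat, List.map_cons, List.sum_cons, Matrix.add_apply, Matrix.of_apply] at ih ⊢
    rw [ih]

/-- `akltCertMat` is symmetric. [folklore] -/
theorem certMat_apply_comm (n : ℕ) (cert : List (ℚ × ℕ × List (ℕ × ℚ))) (σ τ : Fin n → Fin 3) :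
    akltCertMat n cert σ τ = akltCertMat n cert τ σ := by
  rw [certMat_apply, certMat_apply]
  congr 1
  refine List.map_congr_left fun t _ => ?_
  ring

/-- `akltCertMat` is block diagonal in `akltCfgMag`. [folklore] -/
theorem certMat_apply_eq_zero (n : ℕ) (cert : List (ℚ × ℕ × List (ℕ × ℚ))) {σ τ : Fin n → Fin 3}
    (h : akltCfgMag σ ≠ akltCfgMag τ) : akltCertMat n cert σ τ = 0 := by
  rw [certMat_apply]
  refine List.sum_eq_zero fun x hx => ?_
  obtain ⟨t, -, rfl⟩ := List.mem_map.1 hx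
  by_cases h1 : akltCfgMag σ = t.2.1
  · have h2 : akltCfgMag τ ≠ t.2.1 := fun h2 => h (h1.trans h2.symm)
    simp [akltCertVec, h2]
  · simp [akltCertVec, h1]

/-- **A certificate with nonnegative weights is positive semidefinite over `ℂ`**: each term
`d_t u_t u_tᵀ` with `d_t ≥ 0` and `u_t` real is `d_t • vecMulVec u (star u) ≥ 0`. [folklore] -/
theorem posSemidef_map_certMat (n : ℕ) (cert : List (ℚ × ℕ × List (ℕ × ℚ)))
    (hpos : ∀ t ∈ cert, 0 ≤ t.1) : ((akltCertMat n cert).map ((↑) : ℚ → ℂ)).PosSemidef := by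
  induction cert with
  | nil =>
    simp only [akltCertMat, List.map_nil, List.sum_nil, Matrix.map_zero, Rat.cast_zero]
    exact PosSemidef.zero
  | cons t rest ih =>
    have ht : 0 ≤ t.1 := hpos t (List.mem_cons_self ..)
    have hrest : ∀ t' ∈ rest, 0 ≤ t'.1 := fun t' h => hpos t' (List.mem_cons_of_mem _ h)
    have hsplit : (akltCertMat n (t :: rest)).map ((↑) : ℚ → ℂ) =
        (t.1 : ℂ) • vecMulVec (fun σ => (akltCertVec t σ : ℂ)) (star fun σ => (akltCertVec t σ : ℂ)) +
          (akltCertMat n rest).map ((↑) : ℚ → ℂ) := by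
      ext σ τ
      simp only [akltCertMat, List.map_cons, List.sum_cons, Matrix.map_apply, Matrix.add_apply,
        Matrix.of_apply, Matrix.smul_apply, vecMulVec_apply, Pi.star_apply, smul_eq_mul,
        RCLike.star_def, map_ratCast]
      push_cast
      ring
    rw [hsplit]
    refine PosSemidef.add (PosSemidef.smul (posSemidef_vecMulVec_self_star _) ?_) (ih hrest)
    rw [← Complex.ofReal_ratCast]
    exact Complex.zero_le_real.2 (by exact_mod_cast ht)

/-! #### The certificate theorem -/

/-- **Positivity from a kernel-checked certificate.** Let `bonds` be bonds of distinct sites on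
`Fin n`, `ε ∈ ℚ`, and `cert` a list of weighted vectors with nonnegative weights. If the exact
rational identity `(akltHamMat² - ε akltHamMat)(σ, τ) = (Σ_t d_t u_t u_tᵀ)(σ, τ)` holds for all
configurations with `akltCfgKey σ ≤ akltCfgKey τ` in a common magnetisation block (the hypothesis `hsweep`,
discharged by `decide` on literal data; the other entries follow by symmetry and block
diagonality), then the operator `H = Σ_k P₂(bonds k)` on `Op (Fin n) 3` satisfies
`H² - ε H ≥ 0`. Knabe (1988) §3 (local gaps of short AKLT chains by exact diagonalisation);
Lemm–Sandvik–Yang (2019) §3 ("verifying the finite-size criterion" numerically) — here replaced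
by an exact `LDLᵀ` certificate. [folklore] -/
theorem posSemidef_sq_sub_smul_of_certificate (n : ℕ) {m : ℕ} (bonds : Fin m → Fin n × Fin n)
    (hb : ∀ k, (bonds k).1 ≠ (bonds k).2) (ε : ℚ) (cert : List (ℚ × ℕ × List (ℕ × ℚ)))
    (hpos : ∀ t ∈ cert, 0 ≤ t.1)
    (hsweep : ∀ σ τ : Fin n → Fin 3, akltCfgKey σ ≤ akltCfgKey τ → akltCfgMag σ = akltCfgMag τ →
      akltMspEntry n bonds ε σ τ = akltCertMat n cert σ τ) :
    ((∑ k : Fin m, akltProj (bonds k).1 (bonds k).2) * (∑ k : Fin m, akltProj (bonds k).1 (bonds k).2) -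
      (ε : ℂ) • ∑ k : Fin m, akltProj (bonds k).1 (bonds k).2).PosSemidef := by
  have hid : akltHamMat n bonds * akltHamMat n bonds - ε • akltHamMat n bonds = akltCertMat n cert := by
    ext σ τ
    by_cases hm : akltCfgMag σ = akltCfgMag τ
    · rcases le_total (akltCfgKey σ) (akltCfgKey τ) with hk | hk
      · rw [← mspEntry_eq]; exact hsweep σ τ hk hm
      · rw [hamMat_sq_sub_apply_comm, certMat_apply_comm, ← mspEntry_eq]
        exact hsweep τ σ hk hm.symm
    · rw [hamMat_sq_sub_apply_eq_zero bonds hb ε hm, certMat_apply_eq_zero n cert hm]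
  rw [sum_akltProj_eq_map_hamMat n bonds hb, ← map_ratCast_mul, ← map_ratCast_sub_smul, hid]
  exact posSemidef_map_certMat n cert hpos

end Certificate

end Literature.MathematicalPhysics.QuantumLattice
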